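import Mathlib
import Summits.MatrixMultiplication.MatrixMultiplication.Theses.HiddenToeplitzCorners

/-!
# Crux `HiddenCorners` (stmt-MatrixMultiplication-7492), line `birth` — stub `stub_corank_one_dense`

Density of the corank-one stratum in the determinantal hypersurface, in the form a LINEAR pencil
`X ↦ T(X) = Σ_ab X_ab • T_ab` needs: if `det T(X) = 0` for every `X` with `rank X + 1 = r`, then
`det T(X) = 0` for every singular `X`.  Purely algebraic proof (no topology):

* `exists_corank_one_line` — a singular `X` lies on a line `t ↦ X + t • Y` all of whose points with
  `t ≠ 0` have rank exactly `r - 1` (transvection normal form `X = P · diag D · P'`,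
  `Matrix.Pivot.exists_list_transvec_mul_diagonal_mul_list_transvec`; `det X = 0` forces a zero
  diagonal entry `D i₀ = 0`; replace every OTHER zero diagonal entry by `t`).
* `det_eq_zero_of_det_add_smul` — if `det (A + t • B) = 0` for all `t ≠ 0` then `det A = 0`
  (`t ↦ det (A + t • B)` is a polynomial of degree `≤ N`, `Polynomial.natDegree_det_X_add_C_le`,
  with the `N + 1` distinct nonzero roots `1, …, N + 1`).
* `pencil_add_smul` — linearity `T(X + t • Y) = T(X) + t • T(Y)`.

`r = 0` needs no separate treatment (the zero diagonal entry `i₀ : Fin 0` is absurd).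
-/

set_option linter.dupNamespace false

namespace Summit.MatrixMultiplication.MatrixMultiplication.Cruxes.HiddenCorners.Birth

open scoped BigOperators Matrix
open Polynomial

/-- Linearity of a linear pencil along a line: `T(X + t • Y) = T(X) + t • T(Y)`. -/
private theorem pencil_add_smul {r N : ℕ} (T : Fin r → Fin r → Matrix (Fin N) (Fin N) ℂ)
    (X Y : Matrix (Fin r) (Fin r) ℂ) (t : ℂ) :
    (∑ a : Fin r, ∑ b : Fin r, (X + t • Y) a b • T a b) =
      (∑ a : Fin r, ∑ b : Fin r, X a b • T a b) + t • ∑ a : Fin r, ∑ b : Fin r, Y a b • T a b := by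
  simp only [Matrix.add_apply, Matrix.smul_apply, smul_eq_mul, add_smul, Finset.sum_add_distrib,
    Finset.smul_sum, smul_smul]

/-- Determinant along a line: if `det (A + t • B) = 0` for every `t ≠ 0`, then `det A = 0`
(the polynomial `t ↦ det (A + t • B)` has degree `≤ N` and the `N + 1` distinct nonzero roots
`t = 1, …, N + 1`, hence vanishes identically, in particular at `t = 0`). -/
private theorem det_eq_zero_of_det_add_smul {N : ℕ} (A B : Matrix (Fin N) (Fin N) ℂ)
    (h : ∀ t : ℂ, t ≠ 0 → (A + t • B).det = 0) : A.det = 0 := by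
  set Q : ℂ[X] := Matrix.det ((X : ℂ[X]) • B.map C + A.map C) with hQ
  -- evaluation of `Q` at a scalar `t` is `det (A + t • B)`
  have heval : ∀ t : ℂ, Q.eval t = (A + t • B).det := by
    intro t
    rw [hQ, ← Polynomial.coe_evalRingHom, RingHom.map_det]
    congr 1
    ext i j
    simp only [Matrix.add_apply, Matrix.smul_apply, Matrix.map_apply, RingHom.mapMatrix_apply,
      smul_eq_mul, Polynomial.coe_evalRingHom, Polynomial.eval_add, Polynomial.eval_mul,
      Polynomial.eval_X, Polynomial.eval_C]
    ring
  -- degree bound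
  have hdeg : Q.natDegree ≤ N := by
    have h := Polynomial.natDegree_det_X_add_C_le B A
    rwa [Fintype.card_fin] at h
  -- `Q` vanishes at the `N + 1` distinct nonzero points `j + 1`, `j = 0, …, N`
  have hroot : ∀ j : Fin (N + 1), Q.eval ((j : ℂ) + 1) = 0 := by
    intro j
    rw [heval]
    exact h _ (Nat.cast_add_one_ne_zero (j : ℕ))
  have hinj : Function.Injective fun j : Fin (N + 1) => ((j : ℂ) + 1) := by
    intro j j' hjj'
    have h3 : (j : ℕ) = (j' : ℕ) := by exact_mod_cast add_right_cancel hjj'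
    exact Fin.ext h3
  have hQ0 : Q = 0 :=
    Polynomial.eq_zero_of_natDegree_lt_card_of_eval_eq_zero Q hinj hroot
      (by rw [Fintype.card_fin]; omega)
  have h0 : Q.eval 0 = A.det := by
    rw [heval, zero_smul, add_zero]
  rw [← h0, hQ0, Polynomial.eval_zero]

/-- The corank-one stratum is "dense along lines" in the determinantal hypersurface: every singular
`X` lies on a line `t ↦ X + t • Y` all of whose points with `t ≠ 0` have rank exactly `r - 1`
(written as `rank + 1 = r`).  Proof: transvection normal form `X = P · diag D · P'` with
`det P = det P' = 1`; `det X = 0` gives a zero diagonal entry `D i₀`; take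
`Y = P · diag E · P'` with `E` the indicator of the OTHER zero diagonal entries, so that
`X + t • Y = P · diag (D + t • E) · P'` and `D + t • E` has the single zero entry `i₀` for `t ≠ 0`. -/
private theorem exists_corank_one_line {r : ℕ} (X : Matrix (Fin r) (Fin r) ℂ) (hX : X.det = 0) :
    ∃ Y : Matrix (Fin r) (Fin r) ℂ, ∀ t : ℂ, t ≠ 0 → (X + t • Y).rank + 1 = r := by
  classical
  obtain ⟨L, L', D, hXD⟩ := Matrix.Pivot.exists_list_transvec_mul_diagonal_mul_list_transvec X
  set P : Matrix (Fin r) (Fin r) ℂ := (L.map Matrix.TransvectionStruct.toMatrix).prod with hP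
  set P' : Matrix (Fin r) (Fin r) ℂ := (L'.map Matrix.TransvectionStruct.toMatrix).prod with hP'
  have hPdet : P.det = 1 := Matrix.TransvectionStruct.det_toMatrix_prod L
  have hP'det : P'.det = 1 := Matrix.TransvectionStruct.det_toMatrix_prod L'
  -- some diagonal entry vanishes
  have hD : ∃ i₀, D i₀ = 0 := by
    have h1 : (Matrix.diagonal D).det = 0 := by
      have h2 := hX
      rw [hXD, Matrix.det_mul, Matrix.det_mul, hPdet, hP'det, one_mul, mul_one] at h2
      exact h2
    rw [Matrix.det_diagonal] at h1
    obtain ⟨i₀, _, hi₀⟩ := Finset.prod_eq_zero_iff.mp h1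
    exact ⟨i₀, hi₀⟩
  obtain ⟨i₀, hi₀⟩ := hD
  -- the direction: indicator of the other zero diagonal entries, conjugated back
  set E : Fin r → ℂ := fun i => if i ≠ i₀ ∧ D i = 0 then 1 else 0 with hE
  refine ⟨P * Matrix.diagonal E * P', fun t ht => ?_⟩
  have hdiag : Matrix.diagonal (D + t • E) = Matrix.diagonal D + t • Matrix.diagonal E := by
    rw [← Matrix.diagonal_smul, Matrix.diagonal_add]
    rfl
  have hline : X + t • (P * Matrix.diagonal E * P') = P * Matrix.diagonal (D + t • E) * P' := by
    rw [hdiag, Matrix.mul_add, Matrix.add_mul, Matrix.mul_smul, Matrix.smul_mul, ← hXD]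
  -- the perturbed diagonal has exactly the one zero entry `i₀`
  have hsupp : ∀ i, (D + t • E) i ≠ 0 ↔ i ≠ i₀ := by
    intro i
    simp only [Pi.add_apply, Pi.smul_apply, smul_eq_mul, hE]
    by_cases hi : i = i₀
    · subst hi
      simp [hi₀]
    · by_cases hDi : D i = 0
      · simp [hi, hDi, ht]
      · simp [hi, hDi]
  have hcard : Fintype.card {i // (D + t • E) i ≠ 0} = r - 1 := by
    rw [Fintype.card_subtype]
    have hfilter : (Finset.univ.filter fun i => (D + t • E) i ≠ 0) = Finset.univ.erase i₀ := by
      ext i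
      simp only [Finset.mem_filter, Finset.mem_univ, true_and, Finset.mem_erase, and_true]
      exact hsupp i
    rw [hfilter, Finset.card_erase_of_mem (Finset.mem_univ _), Finset.card_univ, Fintype.card_fin]
  have hrank : (X + t • (P * Matrix.diagonal E * P')).rank = r - 1 := by
    rw [hline, Matrix.rank_mul_eq_left_of_isUnit_det P' _ (by rw [hP'det]; exact isUnit_one),
      Matrix.rank_mul_eq_right_of_isUnit_det P _ (by rw [hPdet]; exact isUnit_one),
      Matrix.rank_diagonal, hcard]
  have hr : 0 < r := Fin.pos i₀
  rw [hrank]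
  omega

/-- STUB 2 of the line `birth` — density of the corank-one stratum in the determinantal hypersurface,
in the form the pencil needs: if the (polynomial) function `X ↦ det T(X)` of a linear pencil
`T(X) = Σ_ab X_ab • T_ab` vanishes on every `X` with `rank X + 1 = r`, it vanishes on every singular
`X`.  Proof: put the singular `X` on a line `X + t • Y` of rank-`(r - 1)` matrices (`t ≠ 0`,
`exists_corank_one_line`); by linearity `det T(X + t • Y) = det (T(X) + t • T(Y))` vanishes for all
`t ≠ 0`, hence at `t = 0` (`det_eq_zero_of_det_add_smul`). -/
theorem stub_corank_one_dense :
    ∀ (r N : ℕ) (T : Fin r → Fin r → Matrix (Fin N) (Fin N) ℂ),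
      (∀ X : Matrix (Fin r) (Fin r) ℂ, X.rank + 1 = r →
        (∑ a : Fin r, ∑ b : Fin r, X a b • T a b).det = 0) →
      ∀ X : Matrix (Fin r) (Fin r) ℂ, X.det = 0 →
        (∑ a : Fin r, ∑ b : Fin r, X a b • T a b).det = 0 := by
  intro r N T hcorank X hX
  obtain ⟨Y, hY⟩ := exists_corank_one_line X hX
  refine det_eq_zero_of_det_add_smul _ (∑ a : Fin r, ∑ b : Fin r, Y a b • T a b) fun t ht => ?_
  rw [← pencil_add_smul]
  exact hcorank _ (hY t ht)

end Summit.MatrixMultiplication.MatrixMultiplication.Cruxes.HiddenCorners.Birth
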